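import Literature.AnabelianGeometry.EtaleTheta.FrobenioidThetaDivisorSupport
import Mathlib.Algebra.BigOperators.Finprod

/-!
# [EtTh] §5, Proposition 5.3 (iv)–(vi): divisor-support vocabulary — REPAIR OF RECORD (`R`, primed declarations)

Mochizuki, *The étale theta function …*, Publ. RIMS **45** (2009)
[cite: MochizukiEtTh2009, Prop 5.3 proof p.326–327 (PDF pp.100–101); Prop 3.2 (i) p.296 (PDF p.70); §1 p.240 (PDF p.14)].
Seat abc-iut-L6-d1 (gen 3), for abc-iut-L2-d4's merge row W3-L2-03 (file of record
`FrobenioidThetaDivisorSupport.lean`, p418923, FROZEN candidate — not touched; G11: append-only repair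
by primed declarations in a NEW file).

WHY A REPAIR.  `FrobenioidThetaDivisorSupportNegative.lean` (this seat) proves that the typed
`DivisorSupportData 𝔓` is uninhabited for every `𝔓`: its field F2 types the factorization homomorphism of
[FrdI] Def. 2.4 (i)(c) with FINITELY supported coordinates (`Primes Φ →₀ ℚ`), whereas F5 asks `div(Θ̈)` to
have order `1` at the infinitely many cuspidal primes.  Print: [EtTh] Prop. 3.2 (i) p.296 (PDF p.70) —
"`DIV_+(Z^log_∞)^pf` may be naturally identified with a direct PRODUCT of copies of `ℚ_{≥0}`, indexed by
the cusps [i.e., irreducible components of the divisor of cusps] and irreducible components of the special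
fiber of `Z^log_∞`"; log-divisors may have infinite support (`div(Θ̈)`: Prop. 1.4 (i)), and "cuspidally
minimal" (p.326 (PDF p.100)) requires the support to be "a finite set" as a condition.

WHAT CHANGES (and nothing else).  F2 becomes PRODUCT-valued:
`factor : Φ(A_⊚) →* (Primes Φ(A_⊚) → Multiplicative ℚ)`; the order at `𝔭` is the `𝔭`-th projection
(`ordOf'`, `ordGpOf'`); supports (`suppOf'`) are possibly infinite sets; `factor_gen` / `factor_carrier`
are spelled coordinatewise (no `DecidableEq` on primes needed); ONE printed field is added at the row
owner's request (abc-iut-L2-d4, 2026-08-26T04:02:45Z): `le_ord_iff`, the support-free sup-characterisation of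
the coordinates of [FrdI] Def. 2.4 (i)(c) (`(n/m)·gen_𝔭 ≤ a` in `Φ^pf` iff `gen_𝔭^n ∣ a^m` in `Φ`); and the
comparison clause of "cuspidally minimal" now quantifies over cuspidal elements of FINITE support (print:
"minimal cardinality among the cardinalities of supports", infinite supports having no finite cardinality).  All other fields (F1 `principal`, F3
`incidence`, F5 `ordGp_divTheta_cusp`, F6 `exists_translate`) and the p.326 definitions are restated
verbatim over the primed vocabulary (`DivisorSupportData'`, `IsCuspidalGpOf'`, `CoprimeOf'`,
`IsCuspidallyMinimalOf'`, `CspToNcspCriterion'`, `CspToNcspWitnessed'`, `AdjacencyCriterion'`); the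
unprimed `LinEquivOf`, `IsPrincipalOf`, `Adjacent`, `ordOf`-free notions of the file of record are REUSED.

ADDED VOCABULARY for GAP-LEDGER row G-L2d4-2 (owner ∅ → this seat): the DEGREE of an element of
`Φ(A_⊚)^gp` on a non-cuspidal prime (= irreducible component `n` of the chain), in the prime-log-divisor
coordinates of F2 —
`degOn 𝔖 𝔫 x = ord_{𝔫⁻} x − 2·ord_𝔫 x + ord_{𝔫⁺} x + Σ_{𝔠 cuspidal, 𝔠 ↦ 𝔫} ord_𝔠 x`
(`𝔫^∓` = the two neighbours in the chain, read on `ncspEquivZ` via `ncspShift`; the cusp sum is a `finsum`, honest on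
elements of finite cuspidal support) — and the predicate `PrincipalIffDegreeZero 𝔖` := "an element of
`Φ(A_⊚)^gp` is principal iff its degree on every irreducible component vanishes".  This predicate is the
STRUCTURAL hypothesis binder `hInt` of the L2-lead ruling 2026-08-26T01:20:55Z: it is NOT a field, NOT a
named fact, and is asserted nowhere; it quotes [EtTh] §1 p.240 (PDF p.14) "the isomorphism class of a line
bundle on `𝔜_N` is completely determined by the degree of the restriction of the line bundle to each of
these copies of the projective line. That is to say, these degrees determine an isomorphism
`Pic(𝔜_N) ⥲ ℤ^ℤ`" (`Ÿ = Y_2`, p.243 (PDF p.17)), combined with the degrees `−2, 1, 1` of a component on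
itself / its neighbours / its cusps (special fibre `= div(π)` principal).  The proof-only companion
`FrobenioidThetaDivisorSupportIntersection.lean` derives the three criteria from it.
HONEST FRAMING: data, definitions and predicates; no field asserts a result about an actual curve
(instances are to be CONSTRUCTED from the model); typed ≠ proved; no side taken on anything downstream;
nothing here lies inside the [IUTchIII] Cor. 3.12 cone. -/

namespace Literature.AnabelianGeometry.EtaleTheta

open CategoryTheory
open Literature.AlgebraicGeometry.Frobenioids

universe w v v' u u'

namespace FrobenioidThetaDivisors

section Defs

variable {Φ : Type w} [CommMonoid Φ]

/-- The order at `𝔭` (REPAIRED F2: product-valued factorization homomorphism, [FrdI] Def. 2.4 (i)(c);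
[EtTh] Prop. 3.2 (i) p.296 (PDF p.70) "direct product of copies of `ℚ_{≥0}`").
[cite: MochizukiEtTh2009, Prop 5.3 proof p.326 (PDF p.100); Prop 3.2 (i) p.296 (PDF p.70)] -/
def ordOf' (factor : Φ →* (Primes Φ → Multiplicative ℚ)) (𝔭 : Primes Φ) : Φ →* Multiplicative ℚ :=
  (Pi.evalMonoidHom (fun _ : Primes Φ => Multiplicative ℚ) 𝔭).comp factor

/-- The order at `𝔭` on `Φ(A_⊚)^gp` (universal property of the Grothendieck group), REPAIRED F2.
[cite: MochizukiEtTh2009, Prop 5.3 proof p.326 (PDF p.100)] -/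
noncomputable def ordGpOf' (factor : Φ →* (Primes Φ → Multiplicative ℚ)) (𝔭 : Primes Φ) :
    Algebra.GrothendieckGroup Φ →* Multiplicative ℚ :=
  Algebra.GrothendieckGroup.lift (ordOf' factor 𝔭)

/-- "support [cf. [FrdI], Definition 2.4, (i), (d)]" of an element of `Φ(A_⊚)^gp` (p.326 (PDF p.100)) —
possibly INFINITE (REPAIRED F2).  [cite: MochizukiEtTh2009, Prop 5.3 proof p.326 (PDF p.100)] -/
def suppOf' (factor : Φ →* (Primes Φ → Multiplicative ℚ)) (x : Algebra.GrothendieckGroup Φ) :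
    Set (Primes Φ) :=
  {𝔭 | ordGpOf' factor 𝔭 x ≠ 1}

/-- "`b` … coprime to `a` [i.e., `a`, `b` have disjoint supports]" (p.326 (PDF p.100)), REPAIRED F2.
[cite: MochizukiEtTh2009, Prop 5.3 proof p.326 (PDF p.100)] -/
def CoprimeOf' (factor : Φ →* (Primes Φ → Multiplicative ℚ)) (x y : Algebra.GrothendieckGroup Φ) : Prop :=
  Disjoint (suppOf' factor x) (suppOf' factor y)

variable {C : Type u} [Category.{v} C] {D : Type u'} [Category.{v'} D] {𝔉 : ThetaFrobenioid.{w} C D}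

/-- A cuspidal element of `Φ(A_⊚)^gp`: support consists of cuspidal primes (p.326 (PDF p.100)), REPAIRED F2.
[cite: MochizukiEtTh2009, Prop 5.3 proof p.326 (PDF p.100); Def 3.1 (i) p.296 (PDF p.70)] -/
def IsCuspidalGpOf' (𝔓 : DivisorPrimeData 𝔉) (factor : 𝔉.PhiAcirc →* (Primes 𝔉.PhiAcirc → Multiplicative ℚ))
    (x : Algebra.GrothendieckGroup 𝔉.PhiAcirc) : Prop :=
  ∀ 𝔭 ∈ suppOf' factor x, 𝔓.IsCuspidal 𝔭

/-- "cuspidally minimal": a cuspidal element of `Φ(A_⊚)^gp` "whose support … is a finite set of minimal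
cardinality among the cardinalities of supports of cuspidal elements of `Φ(A_⊚)^gp` which are linearly
equivalent to the given element" (p.326 (PDF p.100)), REPAIRED F2 (the finiteness is now a genuine condition).
[cite: MochizukiEtTh2009, Prop 5.3 proof p.326 (PDF p.100)] -/
def IsCuspidallyMinimalOf' (𝔓 : DivisorPrimeData 𝔉)
    (factor : 𝔉.PhiAcirc →* (Primes 𝔉.PhiAcirc → Multiplicative ℚ))
    (P : Subgroup (Algebra.GrothendieckGroup 𝔉.PhiAcirc)) (x : Algebra.GrothendieckGroup 𝔉.PhiAcirc) : Prop :=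
  IsCuspidalGpOf' 𝔓 factor x ∧ (suppOf' factor x).Finite ∧
    ∀ y, IsCuspidalGpOf' 𝔓 factor y → (suppOf' factor y).Finite → LinEquivOf P y x →
      (suppOf' factor x).ncard ≤ (suppOf' factor y).ncard

/-- The neighbour at signed distance `t` of a non-cuspidal prime in the "infinite chain of copies of the
projective line" (components "labeled by elements of `ℤ`", §1 p.239–240 (PDF pp.13–14)), read on the labels
`ncspEquivZ`.  [cite: MochizukiEtTh2009, §1 p.239–240 (PDF pp.13–14); Prop 5.3 p.325 (PDF p.99)] -/
def ncspShift (𝔓 : DivisorPrimeData 𝔉) (t : ℤ) (𝔫 : {p : Primes 𝔉.PhiAcirc // ¬ 𝔓.IsCuspidal p}) :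
    {p : Primes 𝔉.PhiAcirc // ¬ 𝔓.IsCuspidal p} :=
  𝔓.ncspEquivZ.symm (𝔓.ncspEquivZ 𝔫 + t)

end Defs

variable {C : Type u} [Category.{v} C] {D : Type u'} [Category.{v'} D] {𝔉 : ThetaFrobenioid.{w} C D}

/-- **The divisor-support vocabulary of the proof of Proposition 5.3, REPAIR OF RECORD** (primed twin of
`DivisorSupportData`, pp.326–327 (PDF pp.100–101)).  Identical to the file of record except that F2 is
PRODUCT-valued ([EtTh] Prop. 3.2 (i) p.296 (PDF p.70)): `factor : Φ(A_⊚) → ∏_𝔭 Φ(A_⊚)^pf_𝔭`, each line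
`Φ(A_⊚)^pf_𝔭 ≅ ℚ_{≥0}·gen_𝔭` coordinatised by the prime log-divisor `gen 𝔭` generating
`Φ(A_⊚)_𝔭 ≅ ℤ_{≥0}` (`C` "of monoid type `ℤ`", [EtTh] Def. 3.6 (i) p.302 (PDF p.76)).  F1 `principal`,
F3 `incidence`, F5 `ordGp_divTheta_cusp`, F6 `exists_translate` as in the file of record.
[cite: MochizukiEtTh2009, Prop 5.3 proof p.326–327 (PDF pp.100–101); Prop 3.2 (i) p.296 (PDF p.70); Def 3.6 (i) p.302 (PDF p.76); Prop 1.4 (i) p.247 (PDF p.21); §1 p.238–240 (PDF pp.12–14)] -/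
structure DivisorSupportData' (𝔓 : DivisorPrimeData 𝔉) where
  /-- F2 (REPAIRED): the factorization homomorphism `Φ(A_⊚) → ∏_𝔭 Φ(A_⊚)^pf_𝔭`, `Φ(A_⊚)^pf_𝔭 ≅ ℚ_{≥0}·gen_𝔭`
  ([FrdI] Def. 2.4 (i)(c); [EtTh] Prop. 3.2 (i): a direct PRODUCT over the primes). -/
  factor : 𝔉.PhiAcirc →* (Primes 𝔉.PhiAcirc → Multiplicative ℚ)
  /-- the factorization homomorphism is injective ([FrdI] Def. 2.4 (i)(c): `Φ` perf-factorial). -/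
  factor_injective : Function.Injective factor
  /-- its coordinates are non-negative (`Φ(A_⊚)^pf_𝔭 ≅ ℚ_{≥0}`). -/
  factor_nonneg : ∀ (a : 𝔉.PhiAcirc) (𝔭 : Primes 𝔉.PhiAcirc), 0 ≤ Multiplicative.toAdd (factor a 𝔭)
  /-- the prime log-divisor of `𝔭` (p.325 (PDF p.99)), the generator of `Φ(A_⊚)_𝔭 ≅ ℤ_{≥0}`. -/
  gen : Primes 𝔉.PhiAcirc → 𝔉.PhiAcirc
  /-- `gen 𝔭` has order `1` at `𝔭` … -/
  factor_gen_self : ∀ 𝔭 : Primes 𝔉.PhiAcirc, factor (gen 𝔭) 𝔭 = Multiplicative.ofAdd 1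
  /-- … and `0` elsewhere. -/
  factor_gen_of_ne : ∀ {𝔭 𝔮 : Primes 𝔉.PhiAcirc}, 𝔮 ≠ 𝔭 → factor (gen 𝔭) 𝔮 = 1
  /-- the primary elements of `𝔭` are exactly the positive multiples of its prime log-divisor
  (`Φ(A_⊚)_𝔭 ≅ ℤ_{≥0}`, [FrdI] Def. 2.4 (i); p.325 (PDF p.99)). -/
  factor_carrier : ∀ (𝔭 : Primes 𝔉.PhiAcirc) (a : 𝔉.PhiAcirc),
    a ∈ 𝔭.carrier ↔ ∃ n : ℕ, 0 < n ∧ factor a 𝔭 = Multiplicative.ofAdd (n : ℚ) ∧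
      ∀ 𝔮 : Primes 𝔉.PhiAcirc, 𝔮 ≠ 𝔭 → factor a 𝔮 = 1
  /-- the `𝔭`-coordinate IS the supremum of [FrdI] Def. 2.4 (i)(c) ("`a ↦ sup(Bound_{𝔭∪{0}}(a))`", the bound
  taken in `Φ^pf`): `(n/m)·gen_𝔭 ≤ a` in `Φ(A_⊚)^pf` iff `gen_𝔭^n ∣ a^m` in `Φ(A_⊚)` — the support-free
  characterisation of the coordinates (requested by the row owner abc-iut-L2-d4, 2026-08-26T04:02:45Z, so that
  the compatibility of orders with monoid isomorphisms stays derivable for infinitely supported elements).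
  [FrdI] Def. 2.4 (i)(c), kurims p.47. -/
  le_ord_iff : ∀ (𝔭 : Primes 𝔉.PhiAcirc) (a : 𝔉.PhiAcirc) (n m : ℕ), 0 < m →
    ((n : ℚ) ≤ m * Multiplicative.toAdd (factor a 𝔭) ↔ gen 𝔭 ^ n ∣ a ^ m)
  /-- F1: "the image of the birational function monoid of the Frobenioid `C`" in `Φ(A_⊚)^gp` (p.326 (PDF p.100)). -/
  principal : Subgroup (Algebra.GrothendieckGroup 𝔉.PhiAcirc)
  /-- F3 (p.326 (PDF p.100)), verbatim as in the file of record: "in this situation, `n` is linearly equivalent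
  to some element ∈ `Φ(A_⊚)^gp` of the form `n₁ + n₂ − a`, where `n₁, n₂ ∈ Φ(A_⊚)^csp` are primary cuspidal
  elements that map, respectively, via the natural surjection of (iv) to the two non-cuspidal primes that are
  adjacent … to the non-cuspidal prime determined by `n`. Moreover, relative to the isomorphisms of (iii), the
  multiplicities of `n₁, n₂` are equal to each other as well as to half the multiplicity of `a`." -/
  incidence : ∀ (𝔞 𝔫 : Primes 𝔉.PhiAcirc) (h𝔫 : ¬ 𝔓.IsCuspidal 𝔫) (a b n : 𝔉.PhiAcirc),
    𝔓.IsCuspidal 𝔞 → a ∈ 𝔞.carrier → n ∈ 𝔫.carrier →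
    IsCuspidalGpOf' 𝔓 factor (Algebra.GrothendieckGroup.of b) →
    CoprimeOf' factor (Algebra.GrothendieckGroup.of a) (Algebra.GrothendieckGroup.of b) →
    IsCuspidallyMinimalOf' 𝔓 factor principal
      (Algebra.GrothendieckGroup.of b * (Algebra.GrothendieckGroup.of a)⁻¹) →
    LinEquivOf principal (Algebra.GrothendieckGroup.of b * (Algebra.GrothendieckGroup.of a)⁻¹)
      (Algebra.GrothendieckGroup.of n) →
    ∃ (𝔠₁ 𝔠₂ : Primes 𝔉.PhiAcirc) (h₁ : 𝔓.IsCuspidal 𝔠₁) (h₂ : 𝔓.IsCuspidal 𝔠₂) (m : ℕ),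
      𝔓.ncspEquivZ (𝔓.cspToNcsp ⟨𝔠₁, h₁⟩) = 𝔓.ncspEquivZ ⟨𝔫, h𝔫⟩ - 1 ∧
      𝔓.ncspEquivZ (𝔓.cspToNcsp ⟨𝔠₂, h₂⟩) = 𝔓.ncspEquivZ ⟨𝔫, h𝔫⟩ + 1 ∧
      ordOf' factor 𝔞 a = Multiplicative.ofAdd (2 * (m : ℚ)) ∧
      LinEquivOf principal (Algebra.GrothendieckGroup.of n)
        (Algebra.GrothendieckGroup.of (gen 𝔠₁ ^ m * gen 𝔠₂ ^ m) *
          (Algebra.GrothendieckGroup.of a)⁻¹)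
  /-- F5 (Prop. 1.4 (i), p.247 (PDF p.21), read on `div(Θ̈)` of Prop. 5.3 (vi)): `div(Θ̈)` has order exactly
  `1` at every cuspidal prime. -/
  ordGp_divTheta_cusp : ∀ 𝔠 : Primes 𝔉.PhiAcirc, 𝔓.IsCuspidal 𝔠 →
    ordGpOf' factor 𝔠 𝔓.divTheta = Multiplicative.ofAdd 1
  /-- F6: every translation `t ∈ ℤ` of the chain of components is realised by some `g ∈ Aut_C(A_⊚)`
  (§1 p.238–239 (PDF pp.12–13); Prop. 5.3 (vi) p.326 (PDF p.100)), verbatim as in the file of record. -/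
  exists_translate : ∀ t : ℤ, ∃ g : Aut 𝔉.Acirc,
    (∀ 𝔭, 𝔓.IsCuspidal (Primes.congr (𝔉.pullAut g) 𝔭) ↔ 𝔓.IsCuspidal 𝔭) ∧
    ∀ (𝔭 : Primes 𝔉.PhiAcirc) (h𝔭 : ¬ 𝔓.IsCuspidal 𝔭) (h𝔭' : ¬ 𝔓.IsCuspidal (Primes.congr (𝔉.pullAut g) 𝔭)),
      𝔓.ncspEquivZ ⟨Primes.congr (𝔉.pullAut g) 𝔭, h𝔭'⟩ = 𝔓.ncspEquivZ ⟨𝔭, h𝔭⟩ + t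

namespace DivisorSupportData'

variable {𝔓 : DivisorPrimeData 𝔉}

/-- the order at `𝔭` on `Φ(A_⊚)^gp`. [cite: MochizukiEtTh2009, Prop 5.3 proof p.326 (PDF p.100)] -/
noncomputable def ordGp (𝔖 : DivisorSupportData' 𝔓) (𝔭 : Primes 𝔉.PhiAcirc) : Algebra.GrothendieckGroup 𝔉.PhiAcirc →* Multiplicative ℚ :=
  ordGpOf' 𝔖.factor 𝔭

/-- the (additive, `ℚ`-valued) order at `𝔭` of `x ∈ Φ(A_⊚)^gp`, i.e. its `gen 𝔭`-coordinate.
[cite: MochizukiEtTh2009, Prop 5.3 proof p.326 (PDF p.100)] -/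
noncomputable def ord (𝔖 : DivisorSupportData' 𝔓) (𝔭 : Primes 𝔉.PhiAcirc) (x : Algebra.GrothendieckGroup 𝔉.PhiAcirc) : ℚ :=
  Multiplicative.toAdd (𝔖.ordGp 𝔭 x)

/-- the support of an element of `Φ(A_⊚)^gp`. [cite: MochizukiEtTh2009, Prop 5.3 proof p.326 (PDF p.100)] -/
def supp (𝔖 : DivisorSupportData' 𝔓) (x : Algebra.GrothendieckGroup 𝔉.PhiAcirc) : Set (Primes 𝔉.PhiAcirc) := suppOf' 𝔖.factor x

/-- linear equivalence in `Φ(A_⊚)^gp`. [cite: MochizukiEtTh2009, Prop 5.3 proof p.326 (PDF p.100)] -/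
def LinEquiv (𝔖 : DivisorSupportData' 𝔓) (x y : Algebra.GrothendieckGroup 𝔉.PhiAcirc) : Prop := LinEquivOf 𝔖.principal x y

/-- principal elements of `Φ(A_⊚)^gp`. [cite: MochizukiEtTh2009, Prop 5.3 proof p.326 (PDF p.100)] -/
def IsPrincipal (𝔖 : DivisorSupportData' 𝔓) (x : Algebra.GrothendieckGroup 𝔉.PhiAcirc) : Prop := IsPrincipalOf 𝔖.principal x

/-- cuspidal elements of `Φ(A_⊚)^gp`. [cite: MochizukiEtTh2009, Prop 5.3 proof p.326 (PDF p.100)] -/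
def IsCuspidalGp (𝔖 : DivisorSupportData' 𝔓) (x : Algebra.GrothendieckGroup 𝔉.PhiAcirc) : Prop := IsCuspidalGpOf' 𝔓 𝔖.factor x

/-- cuspidally minimal elements of `Φ(A_⊚)^gp`. [cite: MochizukiEtTh2009, Prop 5.3 proof p.326 (PDF p.100)] -/
def IsCuspidallyMinimal (𝔖 : DivisorSupportData' 𝔓) (x : Algebra.GrothendieckGroup 𝔉.PhiAcirc) : Prop :=
  IsCuspidallyMinimalOf' 𝔓 𝔖.factor 𝔖.principal x

/-- **The degree on an irreducible component.**  For `x ∈ Φ(A_⊚)^gp` and a non-cuspidal prime `𝔫` (an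
irreducible component `n` of the chain, p.325 (PDF p.99)), the degree of [the line bundle of] `x` restricted
to `n`, in the prime-log-divisor coordinates of F2:
`ord_{𝔫⁻} x − 2·ord_𝔫 x + ord_{𝔫⁺} x + Σ_{𝔠 cuspidal, 𝔠 ↦ 𝔫} ord_𝔠 x` — each neighbouring component meets
`n` in one node, `n·n = −2` because the special fibre `Σ_j n_j` is principal, and each cusp lying on `n`
(the surjection of (iv)) meets it once.  The cusp sum is a `finsum` (honest for elements whose cuspidal support
over `𝔫` is finite).  ([EtTh] §1 p.240 (PDF p.14): "the isomorphism class of a line bundle on `𝔜_N` is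
completely determined by the degree of the restriction of the line bundle to each of these copies of the
projective line".)  [cite: MochizukiEtTh2009, §1 p.240 (PDF p.14); Prop 5.3 proof p.326 (PDF p.100)] -/
noncomputable def degOn (𝔖 : DivisorSupportData' 𝔓) (𝔫 : {p : Primes 𝔉.PhiAcirc // ¬ 𝔓.IsCuspidal p})
    (x : Algebra.GrothendieckGroup 𝔉.PhiAcirc) : ℚ :=
  𝔖.ord (ncspShift 𝔓 (-1) 𝔫).1 x - 2 * 𝔖.ord 𝔫.1 x + 𝔖.ord (ncspShift 𝔓 1 𝔫).1 x +
    ∑ᶠ 𝔠 ∈ {𝔠 : {p : Primes 𝔉.PhiAcirc // 𝔓.IsCuspidal p} | 𝔓.cspToNcsp 𝔠 = 𝔫}, 𝔖.ord 𝔠.1 x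

/-- **HYPOTHESIS BINDER `hInt` of GAP-LEDGER row G-L2d4-2** (a predicate on the data, asserted nowhere; to be
PROVED for the genuine special fibre of `Ÿ`): "an element of `Φ(A_⊚)^gp` is principal if and only if its
degree on every irreducible component of the chain vanishes" — [EtTh] §1 p.240 (PDF p.14) "these degrees
determine an isomorphism `Pic(𝔜_N) ⥲ ℤ^ℤ`" (`Ÿ = Y_2`, p.243 (PDF p.17)), i.e. the "well-known intersection
theory of divisors supported on the chain of copies of the projective line" invoked on p.326 (PDF p.100).
[cite: MochizukiEtTh2009, §1 p.240 (PDF p.14); Prop 5.3 proof p.326 (PDF p.100)] -/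
def PrincipalIffDegreeZero (𝔖 : DivisorSupportData' 𝔓) : Prop :=
  ∀ x : Algebra.GrothendieckGroup 𝔉.PhiAcirc, 𝔖.IsPrincipal x ↔ ∀ 𝔫, 𝔖.degOn 𝔫 x = 0

end DivisorSupportData'

/-! ### The two verbatim criteria of the printed proof, over the repaired data -/

variable {𝔓 : DivisorPrimeData 𝔉}

/-- **The p.326 description of the surjection of (iv)** (primed twin of `CspToNcspCriterion` over the repaired
data): whenever `a ∈ 𝔞` is primary cuspidal and, for some cuspidal `b` coprime to `a`, `b − a` is cuspidally
minimal and linearly equivalent to a primary non-cuspidal `n ∈ 𝔫`, one has `cspToNcsp(𝔞) = 𝔫`.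
[cite: MochizukiEtTh2009, Prop 5.3 proof p.326 (PDF p.100)] -/
def CspToNcspCriterion' (𝔖 : DivisorSupportData' 𝔓) : Prop :=
  ∀ (𝔞 𝔫 : Primes 𝔉.PhiAcirc) (h𝔞 : 𝔓.IsCuspidal 𝔞) (h𝔫 : ¬ 𝔓.IsCuspidal 𝔫) (a b n : 𝔉.PhiAcirc),
    a ∈ 𝔞.carrier → n ∈ 𝔫.carrier →
    𝔖.IsCuspidalGp (Algebra.GrothendieckGroup.of b) →
    CoprimeOf' 𝔖.factor (Algebra.GrothendieckGroup.of a) (Algebra.GrothendieckGroup.of b) →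
    𝔖.IsCuspidallyMinimal (Algebra.GrothendieckGroup.of b * (Algebra.GrothendieckGroup.of a)⁻¹) →
    𝔖.LinEquiv (Algebra.GrothendieckGroup.of b * (Algebra.GrothendieckGroup.of a)⁻¹)
      (Algebra.GrothendieckGroup.of n) →
    𝔓.cspToNcsp ⟨𝔞, h𝔞⟩ = ⟨𝔫, h𝔫⟩

/-- The situation of (iv) occurs at every cusp (primed twin of `CspToNcspWitnessed`).
[cite: MochizukiEtTh2009, Prop 5.3 proof p.326 (PDF p.100)] -/
def CspToNcspWitnessed' (𝔖 : DivisorSupportData' 𝔓) : Prop :=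
  ∀ (𝔞 : Primes 𝔉.PhiAcirc), 𝔓.IsCuspidal 𝔞 → ∃ (𝔫 : Primes 𝔉.PhiAcirc) (_ : ¬ 𝔓.IsCuspidal 𝔫)
    (a b n : 𝔉.PhiAcirc), a ∈ 𝔞.carrier ∧ n ∈ 𝔫.carrier ∧
      𝔖.IsCuspidalGp (Algebra.GrothendieckGroup.of b) ∧
      CoprimeOf' 𝔖.factor (Algebra.GrothendieckGroup.of a) (Algebra.GrothendieckGroup.of b) ∧
      𝔖.IsCuspidallyMinimal (Algebra.GrothendieckGroup.of b * (Algebra.GrothendieckGroup.of a)⁻¹) ∧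
      𝔖.LinEquiv (Algebra.GrothendieckGroup.of b * (Algebra.GrothendieckGroup.of a)⁻¹)
        (Algebra.GrothendieckGroup.of n)

/-- **The pp.326–327 adjacency criterion of (v)** (primed twin of `AdjacencyCriterion` over the repaired data):
"if `a ∈ 𝔭`, `b ∈ 𝔮` correspond via the natural isomorphisms of (ii), then `𝔭, 𝔮` are adjacent
(respectively, not adjacent) if and only if every cuspidally minimal `c ∈ Φ(A_⊚)^gp` which is linearly
equivalent to `a + b` has support of cardinality `4` (respectively, `5` or `6`)."
[cite: MochizukiEtTh2009, Prop 5.3 proof p.326–327 (PDF pp.100–101)] -/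
def AdjacencyCriterion' (𝔖 : DivisorSupportData' 𝔓) : Prop :=
  ∀ (𝔭 𝔮 : Primes 𝔉.PhiAcirc) (h𝔭 : ¬ 𝔓.IsCuspidal 𝔭) (h𝔮 : ¬ 𝔓.IsCuspidal 𝔮), 𝔭 ≠ 𝔮 →
    ∀ a : 𝔭.submonoid, (a : 𝔉.PhiAcirc) ∈ 𝔭.carrier →
    let b : 𝔉.PhiAcirc := 𝔓.ncspIso 𝔭 𝔮 h𝔭 h𝔮 a
    (Adjacent 𝔓 ⟨𝔭, h𝔭⟩ ⟨𝔮, h𝔮⟩ ↔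
      ∀ c, 𝔖.IsCuspidallyMinimal c →
        𝔖.LinEquiv c (Algebra.GrothendieckGroup.of (a : 𝔉.PhiAcirc) * Algebra.GrothendieckGroup.of b) →
          (𝔖.supp c).ncard = 4) ∧
    (¬ Adjacent 𝔓 ⟨𝔭, h𝔭⟩ ⟨𝔮, h𝔮⟩ ↔
      ∀ c, 𝔖.IsCuspidallyMinimal c →
        𝔖.LinEquiv c (Algebra.GrothendieckGroup.of (a : 𝔉.PhiAcirc) * Algebra.GrothendieckGroup.of b) →
          (𝔖.supp c).ncard = 5 ∨ (𝔖.supp c).ncard = 6)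

end FrobenioidThetaDivisors

end Literature.AnabelianGeometry.EtaleTheta
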